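import Literature.AlgebraicGeometry.HodgeTheory.BettiKunnethPieceHodgeClassActions
import Literature.AlgebraicGeometry.HodgeTheory.BettiHodgeConjectureProductOfSurfacesCorrespondenceCriterion
import Literature.AlgebraicGeometry.HodgeTheory.BettiHodgeConjectureCurveTimesVarietyCorrespondenceCriterion
import HarnessLib

/-!
# `HC(Y × Z)` and morphisms of Hodge structures: `HC(Y × Z)` implies that every lattice-preserving map `H^{2n−j}(Z;ℂ) → Hⁱ(Y;ℂ)` of bidegree `(c − n, c − n)` — every morphism of Hodge structures
# `H^{2n−j}(Z) → Hⁱ(Y)(c − n)` — is induced by an algebraic correspondence; conversely when the other Künneth pieces are algebraic; `HC(S × S')` for two surfaces IFF every morphism of Hodge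
# structures `H²(S') → H²(S)` is induced by an algebraic class of `H⁴(S × S')`; `HC(C × T)` IFF every morphism `H³(T) → H¹(C)(−1)` is
# (Voisin I §7.3.1 Def. 7.22, §11.3.3 Thm. 11.38–11.40, Lemma 11.41, pp. 285–287; Voisin II (10.7); Voisin 2025 §3.2.1; Deligne 2000 §1)

Family `hodge`, lane `lit-hodgefound` (Track 2 foundations library; Layers A1/A4), layer `Literature/AlgebraicGeometry/HodgeTheory`.  THEOREMS ONLY (no definition, no named fact, no instance;
D-0026 net debt `0`).  The seat's g30-#14 proved Lemma 11.41 on the carriers: the Hodge classes `t` of the Künneth summand `Hⁱ(Y;ℚ) ⊗ Hʲ(Z;ℚ)` (`i + j = 2c`) correspond, by `t ↦ (crossMap t ⊗ 1)_*`,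
to the ℂ-linear maps `f : Hᵃ(Z;ℂ) → Hⁱ(Y;ℂ)` (`a = 2n − j`) that preserve rational classes, shift Hodge types by `(c − n, c − n)` and kill the types below — the carrier form of «morphism of Hodge
structures `Hᵃ(Z) → Hⁱ(Y)(c − n)`» (Def. 7.22), called TYPE-SHIFTING maps below.  This file reads the seat's correspondence criteria for `HC(Y × Z)` (g30-#3/#5/#7) in that language.  §1
`HC(Y × Z)` ⇒ every type-shifting `f` is the action of an ALGEBRAIC class (indeed of the algebraic Hodge class `crossMap t` of the summand).  §2 Conversely, when the Hodge classes of the other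
Künneth pieces of `H^{2c}(Y × Z)` have algebraic cross products (g30-#5's hypothesis `hother`), the piece `Hⁱ(Y) ⊗ Hʲ(Z)` is algebraic iff every type-shifting `f : Hᵃ(Z;ℂ) → Hⁱ(Y;ℂ)` is the action
of some rational algebraic class of `H^{2c}(Y × Z)`.  §3 The classical readings: **`HC(S × S')` for two smooth projective surfaces iff every ℂ-linear `H²(S';ℂ) → H²(S;ℂ)` preserving rational
classes and Hodge types (every morphism of Hodge structures `H²(S') → H²(S)`) is the action of a rational algebraic class of `H⁴(S × S')`**; **`HC(C × T)` for a curve and a threefold iff every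
ℂ-linear `H³(T;ℂ) → H¹(C;ℂ)` preserving rational classes, of bidegree `(−1, −1)` and killing `H^{3,0} ⊕ H^{0,3}` (every morphism `H³(T) → H¹(C)(−1)`, i.e. every homomorphism `J²(T) → J(C)` of
Hodge structures) is the action of a rational algebraic class of `H⁴(C × T)`**.

WHAT IS PROVED.
* §1 **`BettiUniverse.exists_algebraic_crossMap_corrAction_eq_of_typeShift_of_hodgeConjectureFor`**, **`BettiUniverse.exists_algebraic_corrAction_eq_of_typeShift_of_hodgeConjectureFor`**.
* §2 **`BettiUniverse.kunneth_piece_algebraic_iff_forall_typeShift_exists_algebraic_of_forall_ne`** (and the unconditional «⇒» **`BettiUniverse.forall_typeShift_exists_algebraic_of_kunneth_piece_algebraic`**).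
* §3 **`BettiUniverse.hodgeConjectureFor_tensor_surfaces_iff_forall_hodgeMorphism_exists_algebraic`**, **`BettiUniverse.hodgeConjectureFor_curve_tensor_threefold_iff_forall_hodgeMorphism_exists_algebraic`**.

THE PRINTS.  C. Voisin (2002) [VoisinHodgeI2002] §7.3.1 Def. 7.22; §11.3.3 Thm. 11.38–11.40, Lemma 11.41 and pp. 285–287; §12.1.  C. Voisin (2003) [VoisinHodgeII2003] §10.2.2 proof of Thm. 10.17, (10.7).  C. Voisin (2025)
[Voisin2025] §3.2.1 (12)–(14), Prop. 3.8, Cor. 3.9.  P. Deligne (2000/2006) [Deligne2000] §1.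

THE OBJECTS (all the tree's).  `corrAction complexOrientationFamily hY hZ hab`, `BettiUniverse.crossMap`, `BettiUniverse.kunnethSummand`, `hodgeClasses`, `IsOfHodgeType`, `IsRationalClass`, `ofRatClass`, `algebraicClasses`,
`HodgeConjectureFor`; the seat's g30-#14 `BettiUniverse.exists_mem_hodgeClasses_corrAction_crossMap_eq_of_typeShift`, `…typeShift_corrAction_crossMap_of_mem_hodgeClasses`, `…mem_hodgeClasses_kunnethSummand_iff_isOfHodgeType`,
g30-#5 `…ofRatClass_crossMap_mem_algebraicClasses_of_corrAction_eq_of_forall_ne`, `…hodgeConjectureFor_tensor_surfaces_iff_forall_exists_corrAction_eq`, g30-#7 `…hodgeConjectureFor_curve_tensor_threefold_iff_forall_exists_corrAction_eq`.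

DEVIATIONS / SCOPE.  Complex orientations.  «Morphism of Hodge structures» is the carrier condition (rational lattices + Hodge types), not a `HodgeStructure.Hom` term.  No definitions.

## References
* [VoisinHodgeI2002] C. Voisin, *Hodge Theory and Complex Algebraic Geometry I* (2002) — §7.3.1 Def. 7.22; §11.3.3 Thm. 11.38–11.40, Lemma 11.41, pp. 285–287; §12.1.
* [VoisinHodgeII2003] C. Voisin, *Hodge Theory and Complex Algebraic Geometry II* (2003) — §10.2.2 proof of Thm. 10.17 (10.7).
* [Voisin2025] C. Voisin, *Cycle classes on algebraic varieties* (2025) — §3.2.1 (12)–(14), Prop. 3.8, Cor. 3.9.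
* [Deligne2000] P. Deligne, *The Hodge conjecture* (Clay problem description) — §1.

## Provenance
Lane `lit-hodgefound` (Hodge path, Track 2), prover seat `lit-hodgefound-p29` (generation 30), self-proposed row g30-#15 (the correspondence criteria read through Lemma 11.41 on carriers).
-/

noncomputable section

open scoped TensorProduct
open CategoryTheory MonoidalCategory CartesianMonoidalCategory Module Finset
open Literature.AlgebraicTopology.SingularHomology
open Literature.Geometry.Kaehler

namespace Literature.AlgebraicGeometry.HodgeTheory

open Literature.AlgebraicGeometry.Motives
open Literature.AlgebraicGeometry.Motives.HodgeStructure

variable {m n d : ℕ} {Y Z S S' C T : SchemeOver ℂ}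

variable [HodgeTensorFacts.{0, 0}]

/-! ### §1 `HC(Y × Z)` ⇒ every morphism of Hodge structures is induced by an algebraic correspondence -/

/-- **`HC(Y × Z)` ⇒ every type-shifting `f : Hᵃ(Z;ℂ) → Hⁱ(Y;ℂ)` (rational classes to rational classes, type `(p, q)` to `(p + c − n, q + c − n)`, killing the types below) is the action
`(crossMap t ⊗ 1)_*` of a Hodge class `t` of `Hⁱ(Y;ℚ) ⊗ Hʲ(Z;ℚ)` whose cross product is ALGEBRAIC** (`i + j = 2c`, `a + j = 2 dim Z`; complex orientations): Lemma 11.41 (the seat's g30-#14) gives the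
Hodge class, `HC(Y × Z)` makes it algebraic. [cite: VoisinHodgeI2002, §7.3.1 Def. 7.22, §11.3.3 Lemma 11.41 and pp. 285–287] [cite: Voisin2025, §3.2.1 (12)–(14), Prop. 3.8 and Cor. 3.9] [cite: Deligne2000, §1] -/
theorem BettiUniverse.exists_algebraic_crossMap_corrAction_eq_of_typeShift_of_hodgeConjectureFor (hHD : exists_isReal_hodgeModel) (hY : IsSmoothProjective m Y) (hZ : IsSmoothProjective n Z)
    (hHC : HodgeConjectureFor (m + n) (Y ⊗ Z)) {c i j a : ℕ} (hij : i + j = 2 * c) (haj : a + j = 2 * n) (hab : a + 2 * c = i + 2 * n) (f : complexBetti Z a →ₗ[ℂ] complexBetti Y i)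
    (hR : ∀ u, IsRationalClass u → IsRationalClass (f u))
    (hS : ∀ (p q : ℕ), p + q = a → ∀ u : complexBetti Z a, IsOfHodgeType n Z a p q u → ∀ p' q' : ℕ, p' + n = p + c → q' + n = q + c → IsOfHodgeType m Y i p' q' (f u))
    (hV : ∀ (p q : ℕ), p + q = a → ∀ u : complexBetti Z a, IsOfHodgeType n Z a p q u → p + c < n ∨ q + c < n → f u = 0) :
    ∃ t ∈ (BettiUniverse.kunnethSummand hHD hY hZ (2 * c) ⟨(i, j), mem_antidiagonal.2 hij⟩).hodgeClasses c,
      ofRatClass (ComplexPoints (Y ⊗ Z)) (2 * c) (BettiUniverse.crossMap Y Z hij t) ∈ algebraicClasses (Y ⊗ Z) c ∧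
      corrAction complexOrientationFamily hY hZ hab (ofRatClass (ComplexPoints (Y ⊗ Z)) (2 * c) (BettiUniverse.crossMap Y Z hij t)) = f := by
  obtain ⟨t, ht, htf⟩ := BettiUniverse.exists_mem_hodgeClasses_corrAction_crossMap_eq_of_typeShift hHD hY hZ hij haj hab f hR hS hV
  exact ⟨t, ht, hHC.2 c _ (isRationalClass_ofRatClass _) ((BettiUniverse.mem_hodgeClasses_kunnethSummand_iff_isOfHodgeType hHD hY hZ hij t).1 ht), htf⟩

/-- **`HC(Y × Z)` ⇒ every morphism of Hodge structures `Hᵃ(Z) → Hⁱ(Y)(c − n)` (carrier form) is induced by a rational algebraic class of `H^{2c}(Y × Z)`** (`a + 2c = i + 2 dim Z`, `i ≤ 2c`; complex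
orientations). [cite: VoisinHodgeI2002, §7.3.1 Def. 7.22, §11.3.3 Lemma 11.41 and pp. 285–287] [cite: Voisin2025, §3.2.1 (12)–(14), Prop. 3.8 and Cor. 3.9] [cite: Deligne2000, §1] -/
theorem BettiUniverse.exists_algebraic_corrAction_eq_of_typeShift_of_hodgeConjectureFor (hHD : exists_isReal_hodgeModel) (hY : IsSmoothProjective m Y) (hZ : IsSmoothProjective n Z)
    (hHC : HodgeConjectureFor (m + n) (Y ⊗ Z)) {c i a : ℕ} (hab : a + 2 * c = i + 2 * n) (hi : i ≤ 2 * c) (f : complexBetti Z a →ₗ[ℂ] complexBetti Y i)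
    (hR : ∀ u, IsRationalClass u → IsRationalClass (f u))
    (hS : ∀ (p q : ℕ), p + q = a → ∀ u : complexBetti Z a, IsOfHodgeType n Z a p q u → ∀ p' q' : ℕ, p' + n = p + c → q' + n = q + c → IsOfHodgeType m Y i p' q' (f u))
    (hV : ∀ (p q : ℕ), p + q = a → ∀ u : complexBetti Z a, IsOfHodgeType n Z a p q u → p + c < n ∨ q + c < n → f u = 0) :
    ∃ γ : bettiCohomology (Y ⊗ Z) (2 * c), ofRatClass (ComplexPoints (Y ⊗ Z)) (2 * c) γ ∈ algebraicClasses (Y ⊗ Z) c ∧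
      corrAction complexOrientationFamily hY hZ hab (ofRatClass (ComplexPoints (Y ⊗ Z)) (2 * c) γ) = f := by
  obtain ⟨t, -, halg, htf⟩ := BettiUniverse.exists_algebraic_crossMap_corrAction_eq_of_typeShift_of_hodgeConjectureFor hHD hY hZ hHC (show i + (2 * c - i) = 2 * c by omega)
    (show a + (2 * c - i) = 2 * n by omega) hab f hR hS hV
  exact ⟨_, halg, htf⟩

/-! ### §2 The converse when the other Künneth pieces are algebraic -/

/-- **(«⇒», unconditional) If the piece `Hⁱ(Y) ⊗ Hʲ(Z)` of `H^{2c}(Y × Z)` is algebraic then every type-shifting `f : Hᵃ(Z;ℂ) → Hⁱ(Y;ℂ)` (`a + j = 2 dim Z`) is the action of a rational algebraic class of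
`H^{2c}(Y × Z)`** (namely of `crossMap t`, `t` the Hodge class with action `f`). [cite: VoisinHodgeI2002, §11.3.3 Lemma 11.41 and pp. 285–287] [cite: Voisin2025, §3.2.1 (12)–(14)] -/
theorem BettiUniverse.forall_typeShift_exists_algebraic_of_kunneth_piece_algebraic (hHD : exists_isReal_hodgeModel) (hY : IsSmoothProjective m Y) (hZ : IsSmoothProjective n Z) {c i j a : ℕ}
    (hij : i + j = 2 * c) (haj : a + j = 2 * n) (hab : a + 2 * c = i + 2 * n)
    (hpiece : ∀ t ∈ (BettiUniverse.kunnethSummand hHD hY hZ (2 * c) ⟨(i, j), mem_antidiagonal.2 hij⟩).hodgeClasses c,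
      ofRatClass (ComplexPoints (Y ⊗ Z)) (2 * c) (BettiUniverse.crossMap Y Z hij t) ∈ algebraicClasses (Y ⊗ Z) c)
    (f : complexBetti Z a →ₗ[ℂ] complexBetti Y i) (hR : ∀ u, IsRationalClass u → IsRationalClass (f u))
    (hS : ∀ (p q : ℕ), p + q = a → ∀ u : complexBetti Z a, IsOfHodgeType n Z a p q u → ∀ p' q' : ℕ, p' + n = p + c → q' + n = q + c → IsOfHodgeType m Y i p' q' (f u))
    (hV : ∀ (p q : ℕ), p + q = a → ∀ u : complexBetti Z a, IsOfHodgeType n Z a p q u → p + c < n ∨ q + c < n → f u = 0) :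
    ∃ γ : bettiCohomology (Y ⊗ Z) (2 * c), ofRatClass (ComplexPoints (Y ⊗ Z)) (2 * c) γ ∈ algebraicClasses (Y ⊗ Z) c ∧
      corrAction complexOrientationFamily hY hZ hab (ofRatClass (ComplexPoints (Y ⊗ Z)) (2 * c) γ) = f := by
  obtain ⟨t, ht, htf⟩ := BettiUniverse.exists_mem_hodgeClasses_corrAction_crossMap_eq_of_typeShift hHD hY hZ hij haj hab f hR hS hV
  exact ⟨_, hpiece t ht, htf⟩

/-- **The piece `Hⁱ(Y) ⊗ Hʲ(Z)` of `H^{2c}(Y × Z)` is algebraic IFF every type-shifting `f : Hᵃ(Z;ℂ) → Hⁱ(Y;ℂ)` is the action of some rational algebraic class of `H^{2c}(Y × Z)`**, provided the Hodge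
classes of the OTHER pieces of `H^{2c}(Y × Z)` have algebraic cross products (g30-#5's `hother`; then the Künneth component of an algebraic class with the action of a Hodge class of the summand is
algebraic). [cite: VoisinHodgeI2002, §7.3.1 Def. 7.22, §11.3.3 Thm. 11.38–11.40, Lemma 11.41 and pp. 285–287] [cite: Voisin2025, §3.2.1 (12)–(14), Prop. 3.8 and Cor. 3.9] [cite: Deligne2000, §1] -/
theorem BettiUniverse.kunneth_piece_algebraic_iff_forall_typeShift_exists_algebraic_of_forall_ne (hHD : exists_isReal_hodgeModel) (hY : IsSmoothProjective m Y) (hZ : IsSmoothProjective n Z)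
    {c i j a : ℕ} (hij : i + j = 2 * c) (haj : a + j = 2 * n) (hab : a + 2 * c = i + 2 * n)
    (hother : ∀ (i' j' : ℕ) (hij' : i' + j' = 2 * c), (i', j') ≠ (i, j) →
      ∀ u ∈ (BettiUniverse.kunnethSummand hHD hY hZ (2 * c) ⟨(i', j'), HasAntidiagonal.mem_antidiagonal.2 hij'⟩).hodgeClasses c,
        ofRatClass (ComplexPoints (Y ⊗ Z)) (2 * c) (BettiUniverse.crossMap Y Z hij' u) ∈ algebraicClasses (Y ⊗ Z) c) :
    (∀ t ∈ (BettiUniverse.kunnethSummand hHD hY hZ (2 * c) ⟨(i, j), mem_antidiagonal.2 hij⟩).hodgeClasses c,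
        ofRatClass (ComplexPoints (Y ⊗ Z)) (2 * c) (BettiUniverse.crossMap Y Z hij t) ∈ algebraicClasses (Y ⊗ Z) c) ↔
      ∀ f : complexBetti Z a →ₗ[ℂ] complexBetti Y i, (∀ u, IsRationalClass u → IsRationalClass (f u)) →
        (∀ (p q : ℕ), p + q = a → ∀ u : complexBetti Z a, IsOfHodgeType n Z a p q u → ∀ p' q' : ℕ, p' + n = p + c → q' + n = q + c → IsOfHodgeType m Y i p' q' (f u)) →
        (∀ (p q : ℕ), p + q = a → ∀ u : complexBetti Z a, IsOfHodgeType n Z a p q u → p + c < n ∨ q + c < n → f u = 0) →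
          ∃ γ : bettiCohomology (Y ⊗ Z) (2 * c), ofRatClass (ComplexPoints (Y ⊗ Z)) (2 * c) γ ∈ algebraicClasses (Y ⊗ Z) c ∧
            corrAction complexOrientationFamily hY hZ hab (ofRatClass (ComplexPoints (Y ⊗ Z)) (2 * c) γ) = f := by
  refine ⟨fun hpiece f hR hS hV ↦ BettiUniverse.forall_typeShift_exists_algebraic_of_kunneth_piece_algebraic hHD hY hZ hij haj hab hpiece f hR hS hV, fun h t ht ↦ ?_⟩
  obtain ⟨hR, hS, hV⟩ := BettiUniverse.typeShift_corrAction_crossMap_of_mem_hodgeClasses hHD hY hZ hij hab ht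
  obtain ⟨γ, hγ, hact⟩ := h _ hR (fun p q _ u hu p' q' hp hq ↦ hS p q u hu p' q' hp hq) (fun p q _ u hu hlt ↦ hV p q u hu hlt)
  exact BettiUniverse.ofRatClass_crossMap_mem_algebraicClasses_of_corrAction_eq_of_forall_ne complexOrientationFamily hHD hY hZ hij haj hab hother hγ hact

/-! ### §3 Two surfaces; a curve times a threefold -/

/-- **`HC(S × S')` for two smooth projective surfaces IFF every morphism of Hodge structures `H²(S') → H²(S)` is induced by an algebraic correspondence**: `HC(S × S')` iff every ℂ-linear
`f : H²(S';ℂ) → H²(S;ℂ)` mapping rational classes to rational classes and classes of type `(p, q)` to classes of type `(p, q)` is the action `(γ ⊗ 1)_*` of a rational algebraic class `γ` of `H⁴(S × S')`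
(complex orientations).  Combines the seat's g30-#5 (`HC(S × S')` iff the Hodge classes of `H²(S) ⊗ H²(S')` act as algebraic classes do) with g30-#14 (Lemma 11.41 on carriers).
[cite: VoisinHodgeI2002, §7.3.1 Def. 7.22, §11.3.3 Thm. 11.38–11.40, Lemma 11.41 and pp. 285–287] [cite: Voisin2025, §3.2.1 (12)–(14), Prop. 3.8 and Cor. 3.9] [cite: Deligne2000, §1] -/
theorem BettiUniverse.hodgeConjectureFor_tensor_surfaces_iff_forall_hodgeMorphism_exists_algebraic (hHD : exists_isReal_hodgeModel) (hS : IsSmoothProjective 2 S) (hS' : IsSmoothProjective 2 S')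
    (hSS' : IsSmoothProjective 4 (S ⊗ S')) :
    HodgeConjectureFor 4 (S ⊗ S') ↔
      ∀ f : complexBetti S' 2 →ₗ[ℂ] complexBetti S 2, (∀ u, IsRationalClass u → IsRationalClass (f u)) →
        (∀ (p q : ℕ), p + q = 2 → ∀ u : complexBetti S' 2, IsOfHodgeType 2 S' 2 p q u → IsOfHodgeType 2 S 2 p q (f u)) →
          ∃ γ : bettiCohomology (S ⊗ S') (2 * 2), ofRatClass (ComplexPoints (S ⊗ S')) (2 * 2) γ ∈ algebraicClasses (S ⊗ S') 2 ∧
            corrAction complexOrientationFamily hS hS' (rfl : 2 + 2 * 2 = 2 + 2 * 2) (ofRatClass (ComplexPoints (S ⊗ S')) (2 * 2) γ) = f := by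
  rw [BettiUniverse.hodgeConjectureFor_tensor_surfaces_iff_forall_exists_corrAction_eq complexOrientationFamily hHD hS hS' hSS']
  constructor
  · intro h f hR hS₀
    have hS₁ : ∀ (p q : ℕ), p + q = 2 → ∀ u : complexBetti S' 2, IsOfHodgeType 2 S' 2 p q u → ∀ p' q' : ℕ, p' + 2 = p + 2 → q' + 2 = q + 2 → IsOfHodgeType 2 S 2 p' q' (f u) := by
      intro p q hpq u hu p' q' hp hq
      rw [show p' = p by omega, show q' = q by omega]
      exact hS₀ p q hpq u hu
    obtain ⟨t, ht, htf⟩ := BettiUniverse.exists_mem_hodgeClasses_corrAction_crossMap_eq_of_typeShift hHD hS hS' (show 2 + 2 = 2 * 2 by norm_num) (show 2 + 2 = 2 * 2 by norm_num)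
      (rfl : 2 + 2 * 2 = 2 + 2 * 2) f hR hS₁ (fun p q _ u _ hlt ↦ by omega)
    obtain ⟨γ, hγ, hact⟩ := h t ht
    exact ⟨γ, hγ, hact.trans htf⟩
  · intro h t ht
    obtain ⟨hR, hS₀, -⟩ := BettiUniverse.typeShift_corrAction_crossMap_of_mem_hodgeClasses hHD hS hS' (show 2 + 2 = 2 * 2 by norm_num) (rfl : 2 + 2 * 2 = 2 + 2 * 2) ht
    obtain ⟨γ, hγ, hact⟩ := h _ hR (fun p q _ u hu ↦ hS₀ p q u hu p q rfl rfl)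
    exact ⟨γ, hγ, hact⟩

/-- **`HC(C × T)` for a smooth projective curve `C` and threefold `T` IFF every morphism of Hodge structures `H³(T) → H¹(C)(−1)` is induced by an algebraic correspondence**: `HC(C × T)` iff every
ℂ-linear `f : H³(T;ℂ) → H¹(C;ℂ)` mapping rational classes to rational classes, type `(p, q)` (`p + q = 3`) to type `(p − 1, q − 1)` and killing `H^{3,0}(T)`, `H^{0,3}(T)` is the action `(γ ⊗ 1)_*` of a
rational algebraic class `γ` of `H⁴(C × T)` (complex orientations; these `f` are the homomorphisms of Hodge structures underlying `J²(T) → J(C)`).  Combines the seat's g30-#7 with g30-#14.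
[cite: VoisinHodgeI2002, §7.3.1 Def. 7.22, §11.3.3 Thm. 11.38–11.40, Lemma 11.41 and pp. 285–287, §12.1] [cite: Voisin2025, §3.2.1 (12)–(14), Prop. 3.8 and Cor. 3.9] [cite: Deligne2000, §1] -/
theorem BettiUniverse.hodgeConjectureFor_curve_tensor_threefold_iff_forall_hodgeMorphism_exists_algebraic (hHD : exists_isReal_hodgeModel) (hC : IsSmoothProjective 1 C) (hT : IsSmoothProjective 3 T)
    (hCT : IsSmoothProjective d (C ⊗ T)) :
    HodgeConjectureFor d (C ⊗ T) ↔
      ∀ f : complexBetti T 3 →ₗ[ℂ] complexBetti C 1, (∀ u, IsRationalClass u → IsRationalClass (f u)) →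
        (∀ (p q : ℕ), p + q = 3 → ∀ u : complexBetti T 3, IsOfHodgeType 3 T 3 p q u → ∀ p' q' : ℕ, p' + 3 = p + 2 → q' + 3 = q + 2 → IsOfHodgeType 1 C 1 p' q' (f u)) →
        (∀ (p q : ℕ), p + q = 3 → ∀ u : complexBetti T 3, IsOfHodgeType 3 T 3 p q u → p + 2 < 3 ∨ q + 2 < 3 → f u = 0) →
          ∃ γ : bettiCohomology (C ⊗ T) (2 * 2), ofRatClass (ComplexPoints (C ⊗ T)) (2 * 2) γ ∈ algebraicClasses (C ⊗ T) 2 ∧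
            corrAction complexOrientationFamily hC hT (rfl : 3 + 2 * 2 = 1 + 2 * 3) (ofRatClass (ComplexPoints (C ⊗ T)) (2 * 2) γ) = f := by
  rw [BettiUniverse.hodgeConjectureFor_curve_tensor_threefold_iff_forall_exists_corrAction_eq complexOrientationFamily hHD hC hT hCT]
  constructor
  · intro h f hR hS₀ hV
    obtain ⟨t, ht, htf⟩ := BettiUniverse.exists_mem_hodgeClasses_corrAction_crossMap_eq_of_typeShift hHD hC hT (show 1 + 3 = 2 * 2 by norm_num) (show 3 + 3 = 2 * 3 by norm_num)
      (rfl : 3 + 2 * 2 = 1 + 2 * 3) f hR hS₀ hV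
    obtain ⟨γ, hγ, hact⟩ := h t ht
    exact ⟨γ, hγ, hact.trans htf⟩
  · intro h t ht
    obtain ⟨hR, hS₀, hV⟩ := BettiUniverse.typeShift_corrAction_crossMap_of_mem_hodgeClasses hHD hC hT (show 1 + 3 = 2 * 2 by norm_num) (rfl : 3 + 2 * 2 = 1 + 2 * 3) ht
    obtain ⟨γ, hγ, hact⟩ := h _ hR (fun p q _ u hu p' q' hp hq ↦ hS₀ p q u hu p' q' hp hq) (fun p q _ u hu hlt ↦ hV p q u hu hlt)
    exact ⟨γ, hγ, hact⟩

end Literature.AlgebraicGeometry.HodgeTheory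

end
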